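import Summits.Ventures.HSemireg.ObstructionLocusCrossingExtTop
import Summits.Ventures.HSemireg.ObstructionLocusCrossingTFree

/-!
# Venture HSemireg — (S5) OBSTRUCTION LOCUS away from secant type, XLIII: PARTIAL BRANCH TUPLES — the index set of
# EXT-NOTE §6.B(c) in EVERY degree (`τ` = one branch datum `(a_i, b_i)` in each of `q` of the blocks), their ideals
# `J_τ = Σ_{i used} (x_{b_i}, x_{a_i})`, their variables, the free pair of a higher-degree tuple, and the splitting
# of the index set at one block

HONEST FRAMING.  Part of the Lean side of the computation cell `pub-hsemireg` (track «S4-PUSH» (ii), seat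
s4-prove-2).  Finite combinatorics and ideals of variables in `R = MvPolynomial (Fin n) K`, every `n`, EVERY
commutative ring `K`, on top of files XIX (`Branch`, `Blocks.single`), XXVII (`Blocks.restrict`), XXXVII (branch
tuples, `piProdSwapEquiv`) and XXXIX (`varIdeal`).  Nothing here constructs a variety or a sheaf; nothing here says
that HC / HC_CM / HC_AV holds; no Literature fact is declared or used; no object is certified.

CONTENT (for a block structure `B : Blocks ι n`, file XVI).
* `Br B i` (a branch datum `(a, b)` of block `i`), **`PTuple B = Π_i Option (Br B i)`** (PARTIAL branch tuples),
  `owt` ∕ `pdeg` (the number of blocks used), **`PBT B q`** (partial tuples on exactly `q` blocks; `q = r`: file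
  XXXVII's branch tuples; `q = 1`: file XIX's branches; `q = 0`: the empty tuple);
* `optIdeal` ∕ **`ptupleIdeal K B τ = Σ_{i used} (x_{b_i}, x_{a_i})`**, `optVars` ∕ `pvars` and
  `ptupleIdeal_eq_varIdeal` (`J_τ` is the ideal of the variables of `τ`);
* `notMem_pvars_of_eq_none`, `notMem_pvars_restrict` (the variables of a tuple of the OTHER blocks avoid the peeled
  block), **`exists_free_pair`** (a tuple of higher degree uses a block the other does not; that block's two
  variables are the free pair required by file XLII's splitting lemma);
* the splitting at a block `i₀`: `optionProdWtEquiv` (generic), `pdeg_eq_add`, **`pbtSplit B i₀ q :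
  PBT B q ≃ PBT B′ q ⊕ {(t, τ′) : deg τ′ + 1 = q}`** (`B′ = B.restrict (· ≠ i₀)`), the ideal of a rejoined tuple
  (`ptupleIdeal_piSplitAt_symm`), and the re-indexing equivalences of the products of quotients
  **`pbtQuotPiSuccEquiv`** (degree `k + 1`) and **`pbtQuotPiZeroEquiv`** (degree `0`).
References (dictionary only): EXT-NOTE.md §6.B(c), §6.D.
-/

open MvPolynomial Finset
open scoped BigOperators

universe u

namespace Summit.Ventures.HSemireg.ObstructionLocus.BlockModel

variable {K : Type u} [CommRing K] {n : ℕ}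

/-! ## Generic: the weight of an optional datum; splitting a weighted subtype of `Option α × β` -/

section Generic

/-- The weight of an optional datum: `0` for `none`, `1` for `some _`. -/
def owt {α : Type*} : Option α → ℕ
  | none => 0
  | some _ => 1

/-- `owt none = 0`. -/
@[simp] theorem owt_none {α : Type*} : owt (none : Option α) = 0 := rfl

/-- `owt (some a) = 1`. -/
@[simp] theorem owt_some {α : Type*} (a : α) : owt (some a) = 1 := rfl

/-- **`{(o, b) : owt o + d b = q} ≃ {b : d b = q} ⊕ {(a, b) : d b + 1 = q}`** — split on the optional component. -/
def optionProdWtEquiv {α β : Type*} (d : β → ℕ) (q : ℕ) :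
    {p : Option α × β // owt p.1 + d p.2 = q} ≃ {b : β // d b = q} ⊕ {p : α × β // d p.2 + 1 = q} where
  toFun p := match p with
    | ⟨(none, b), h⟩ => Sum.inl ⟨b, by simpa using h⟩
    | ⟨(some a, b), h⟩ => Sum.inr ⟨(a, b), by simp only [owt_some] at h ⊢; omega⟩
  invFun s := match s with
    | Sum.inl b => ⟨(none, b.1), by simp [b.2]⟩
    | Sum.inr p => ⟨(some p.1.1, p.1.2), by have := p.2; simp only [owt_some]; omega⟩
  left_inv p := by
    rcases p with ⟨⟨_ | a, b⟩, h⟩ <;> rfl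
  right_inv s := by
    rcases s with ⟨b, h⟩ | ⟨⟨a, b⟩, h⟩ <;> rfl

end Generic

/-! ## Partial branch tuples, their ideals and their variables -/

section PTuples

variable {ι : Type} (B : Blocks ι n)

/-- A BRANCH DATUM `(a, b)`, `a ∈ S_i`, `b ∈ S_i ∖ a`, of block `i` (file XIX's `Branch` of `Blocks.single S_i`). -/
abbrev Br (i : ι) : Type := Branch (Blocks.single (B.S i) (B.nonempty i))

/-- PARTIAL BRANCH TUPLES: an optional branch datum in every block. -/
abbrev PTuple : Type := (i : ι) → Option (Br B i)

variable (K) in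
/-- The ideal of an optional branch datum: `0` for `none`, `(x_b, x_a)` for `some (a, b)`. -/
noncomputable def optIdeal {i : ι} : Option (Br B i) → Ideal (MvPolynomial (Fin n) K)
  | none => ⊥
  | some t => Ideal.span {(X t.1.2.2 : MvPolynomial (Fin n) K), X t.1.2.1}

/-- The ideal of `none`. -/
@[simp] theorem optIdeal_none {i : ι} : optIdeal K B (none : Option (Br B i)) = ⊥ := rfl

/-- The ideal of `some (a, b)`. -/
@[simp] theorem optIdeal_some {i : ι} (t : Br B i) :
    optIdeal K B (some t) = Ideal.span {(X t.1.2.2 : MvPolynomial (Fin n) K), X t.1.2.1} := rfl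

variable (K) in
/-- The ideal of a partial branch tuple: **`J_τ = Σ_{i used} (x_{b_i}, x_{a_i})`** (cutting out `⋂_{i used} B_i`). -/
noncomputable abbrev ptupleIdeal (τ : PTuple B) : Ideal (MvPolynomial (Fin n) K) := ⨆ i, optIdeal K B (τ i)

/-- The variables of an optional branch datum. -/
def optVars {i : ι} : Option (Br B i) → Finset (Fin n)
  | none => ∅
  | some t => {t.1.2.1, t.1.2.2}

/-- The variables of a branch datum lie in its block. -/
theorem optVars_subset {i : ι} (o : Option (Br B i)) : optVars B o ⊆ B.S i := by
  cases o with
  | none => simp [optVars]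
  | some t =>
    intro c hc
    simp only [optVars, Finset.mem_insert, Finset.mem_singleton] at hc
    rcases hc with rfl | rfl
    · exact t.2.1
    · exact Finset.mem_of_mem_erase t.2.2

/-- The ideal of an optional branch datum is the ideal of its variables. -/
theorem optIdeal_eq_varIdeal {i : ι} (o : Option (Br B i)) : optIdeal K B o = varIdeal K (optVars B o) := by
  cases o with
  | none => simp [optVars, varIdeal]
  | some t =>
    simp only [optIdeal_some, optVars, varIdeal, Finset.coe_insert, Finset.coe_singleton, Set.image_insert_eq,
      Set.image_singleton]
    rw [Set.pair_comm]

/-- The ideal of a union of sets of variables. -/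
theorem varIdeal_union (T₁ T₂ : Finset (Fin n)) : varIdeal K (T₁ ∪ T₂) = varIdeal K T₁ ⊔ varIdeal K T₂ := by
  simp only [varIdeal, Finset.coe_union, Set.image_union, Ideal.span_union]

variable [Fintype ι]

/-- The DEGREE of a partial tuple: the number of blocks it uses. -/
def pdeg (τ : PTuple B) : ℕ := ∑ i, owt (τ i)

/-- PARTIAL BRANCH TUPLES ON EXACTLY `q` BLOCKS. -/
abbrev PBT (q : ℕ) : Type := {τ : PTuple B // pdeg B τ = q}

/-- Decidable equality of partial tuples on `q` blocks, by their underlying tuples (instance search does not assemble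
it through the subtype-of-a-product by itself). -/
instance decidableEqPBT (q : ℕ) : DecidableEq (PBT B q) :=
  fun a b => decidable_of_iff (a.1 = b.1) Subtype.ext_iff.symm

/-- The variables of a partial tuple. -/
def pvars (τ : PTuple B) : Finset (Fin n) := Finset.univ.biUnion fun i => optVars B (τ i)

/-- Membership in `pvars`. -/
theorem mem_pvars_iff (τ : PTuple B) (c : Fin n) : c ∈ pvars B τ ↔ ∃ i, c ∈ optVars B (τ i) := by
  simp [pvars]

/-- **`J_τ` is the ideal of the variables of `τ`.** -/
theorem ptupleIdeal_eq_varIdeal (τ : PTuple B) : ptupleIdeal K B τ = varIdeal K (pvars B τ) := by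
  apply le_antisymm
  · refine iSup_le fun i => ?_
    rw [optIdeal_eq_varIdeal, varIdeal, Ideal.span_le]
    rintro _ ⟨c, hc, rfl⟩
    exact X_mem_varIdeal _ ((mem_pvars_iff B τ c).2 ⟨i, Finset.mem_coe.1 hc⟩)
  · rw [varIdeal, Ideal.span_le]
    rintro _ ⟨c, hc, rfl⟩
    obtain ⟨i, hi⟩ := (mem_pvars_iff B τ c).1 (Finset.mem_coe.1 hc)
    refine Ideal.mem_iSup_of_mem i ?_
    rw [optIdeal_eq_varIdeal]
    exact X_mem_varIdeal _ hi

/-- A variable of a block used by NO datum of `τ` is not a variable of `τ`. -/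
theorem notMem_pvars_of_eq_none (τ : PTuple B) {j : ι} (hj : τ j = none) {c : Fin n} (hc : c ∈ B.S j) :
    c ∉ pvars B τ := by
  intro h
  obtain ⟨i, hi⟩ := (mem_pvars_iff B τ c).1 h
  have hci : c ∈ B.S i := optVars_subset B (τ i) hi
  by_cases hij : i = j
  · subst hij
    rw [hj] at hi
    simp [optVars] at hi
  · exact Finset.disjoint_left.1 (B.disjoint hij) hci hc

variable [DecidableEq ι] (i₀ : ι)

/-- **The variables of a partial tuple of the OTHER blocks avoid the peeled block `S_{i₀}`.** -/
theorem notMem_pvars_restrict (τ' : PTuple (B.restrict (· ≠ i₀))) {a : Fin n} (ha : a ∈ B.S i₀) :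
    a ∉ pvars (B.restrict (· ≠ i₀)) τ' := by
  intro h
  obtain ⟨j, hj⟩ := (mem_pvars_iff _ τ' a).1 h
  have haj : a ∈ B.S j.1 := optVars_subset (B.restrict (· ≠ i₀)) (τ' j) hj
  exact Finset.disjoint_left.1 (B.disjoint j.2) haj ha

/-- **THE FREE PAIR.**  If `τ′` uses more blocks than `τ″` (both partial tuples of the other blocks), some block
`j` carries a datum `(a_j, b_j)` of `τ′` and none of `τ″`; then `a_j ≠ b_j` are variables of `τ′` that avoid the
peeled block `S_{i₀}` and the variables of `τ″`. -/
theorem exists_free_pair (τ' τ'' : PTuple (B.restrict (· ≠ i₀)))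
    (h : pdeg (B.restrict (· ≠ i₀)) τ'' < pdeg (B.restrict (· ≠ i₀)) τ') :
    ∃ u ∈ pvars (B.restrict (· ≠ i₀)) τ', ∃ v ∈ pvars (B.restrict (· ≠ i₀)) τ', u ≠ v ∧
      u ∉ B.S i₀ ∧ v ∉ B.S i₀ ∧ u ∉ pvars (B.restrict (· ≠ i₀)) τ'' ∧ v ∉ pvars (B.restrict (· ≠ i₀)) τ'' := by
  -- a block used by `τ′` and not by `τ″`
  obtain ⟨j, t, hj', hj''⟩ : ∃ j t, τ' j = some t ∧ τ'' j = none := by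
    by_contra hcon
    push Not at hcon
    refine absurd h (not_lt.2 (Finset.sum_le_sum fun j _ => ?_))
    cases h' : τ' j with
    | none => simp
    | some t =>
      obtain ⟨t'', ht''⟩ := Option.ne_none_iff_exists'.1 (hcon j t h')
      rw [ht'']
      simp
  have hu : t.1.2.1 ∈ pvars (B.restrict (· ≠ i₀)) τ' :=
    (mem_pvars_iff _ τ' _).2 ⟨j, by rw [hj']; simp [optVars]⟩
  have hv : t.1.2.2 ∈ pvars (B.restrict (· ≠ i₀)) τ' :=
    (mem_pvars_iff _ τ' _).2 ⟨j, by rw [hj']; simp [optVars]⟩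
  have huS : t.1.2.1 ∈ B.S j.1 := t.2.1
  have hvS : t.1.2.2 ∈ B.S j.1 := Finset.mem_of_mem_erase t.2.2
  have hne : t.1.2.1 ≠ t.1.2.2 := fun h => (Finset.mem_erase.1 t.2.2).1 h.symm
  exact ⟨_, hu, _, hv, hne, fun h => Finset.disjoint_left.1 (B.disjoint j.2) huS h,
    fun h => Finset.disjoint_left.1 (B.disjoint j.2) hvS h,
    notMem_pvars_of_eq_none _ τ'' hj'' huS, notMem_pvars_of_eq_none _ τ'' hj'' hvS⟩

/-! ## Splitting the index set at one block -/

/-- The degree splits at `i₀`. -/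
theorem pdeg_eq_add (τ : PTuple B) :
    pdeg B τ = owt (τ i₀) + pdeg (B.restrict (· ≠ i₀)) (fun j => τ j.1) := by
  rw [pdeg, pdeg]
  exact Fintype.sum_eq_add_sum_subtype_ne _ i₀

/-- **`PBT B q ≃ PBT B′ q ⊕ {(t, τ′) : t ∈ Br(S_{i₀}), deg τ′ + 1 = q}`** (`B′` = the other blocks): a partial tuple on
`q` blocks either misses `i₀` or carries a datum there. -/
def pbtSplit (q : ℕ) :
    PBT B q ≃ PBT (B.restrict (· ≠ i₀)) q ⊕
      {p : Br B i₀ × PTuple (B.restrict (· ≠ i₀)) // pdeg (B.restrict (· ≠ i₀)) p.2 + 1 = q} :=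
  (Equiv.subtypeEquiv (Equiv.piSplitAt i₀ (fun i => Option (Br B i)))
      (fun τ => by rw [pdeg_eq_add B i₀ τ]; rfl)).trans
    (optionProdWtEquiv (pdeg (B.restrict (· ≠ i₀))) q)

omit [Fintype ι] in
/-- The rejoined tuple at `i₀`. -/
theorem piSplitAt_symm_apply_self (p : Option (Br B i₀) × PTuple (B.restrict (· ≠ i₀))) :
    (Equiv.piSplitAt i₀ (fun i => Option (Br B i))).symm p i₀ = p.1 := by
  have h := Equiv.apply_symm_apply (Equiv.piSplitAt i₀ (fun i => Option (Br B i))) p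
  exact (congrArg Prod.fst h :)

omit [Fintype ι] in
/-- The rejoined tuple off `i₀`. -/
theorem piSplitAt_symm_apply_of_ne (p : Option (Br B i₀) × PTuple (B.restrict (· ≠ i₀))) (j : {j // j ≠ i₀}) :
    (Equiv.piSplitAt i₀ (fun i => Option (Br B i))).symm p j = p.2 j := by
  have h := Equiv.apply_symm_apply (Equiv.piSplitAt i₀ (fun i => Option (Br B i))) p
  exact (congrFun (congrArg Prod.snd h) j :)

omit [Fintype ι] in
/-- **The ideal of a rejoined tuple**: `J_{(o, τ′)} = J_o + J_{τ′}`. -/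
theorem ptupleIdeal_piSplitAt_symm (p : Option (Br B i₀) × PTuple (B.restrict (· ≠ i₀))) :
    ptupleIdeal K B ((Equiv.piSplitAt i₀ (fun i => Option (Br B i))).symm p) =
      optIdeal K B p.1 ⊔ ptupleIdeal K (B.restrict (· ≠ i₀)) p.2 := by
  rw [ptupleIdeal, iSup_split_single _ i₀, piSplitAt_symm_apply_self]
  congr 1
  rw [ptupleIdeal, iSup_subtype']
  refine iSup_congr fun j => ?_
  rw [piSplitAt_symm_apply_of_ne]
  cases p.2 j <;> rfl

/-- The rejoined tuple of the first summand, as a partial tuple. -/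
theorem pbtSplit_symm_inl (q : ℕ) (τ' : PBT (B.restrict (· ≠ i₀)) q) :
    ((pbtSplit B i₀ q).symm (Sum.inl τ')).1 =
      (Equiv.piSplitAt i₀ (fun i => Option (Br B i))).symm (none, τ'.1) := rfl

/-- The rejoined tuple of the second summand, as a partial tuple. -/
theorem pbtSplit_symm_inr (q : ℕ)
    (p : {p : Br B i₀ × PTuple (B.restrict (· ≠ i₀)) // pdeg (B.restrict (· ≠ i₀)) p.2 + 1 = q}) :
    ((pbtSplit B i₀ q).symm (Sum.inr p)).1 =
      (Equiv.piSplitAt i₀ (fun i => Option (Br B i))).symm (some p.1.1, p.1.2) := rfl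

/-- The ideal of a rejoined tuple missing `i₀`. -/
theorem ptupleIdeal_pbtSplit_symm_inl (q : ℕ) (τ' : PBT (B.restrict (· ≠ i₀)) q) :
    ptupleIdeal K B ((pbtSplit B i₀ q).symm (Sum.inl τ')).1 = ptupleIdeal K (B.restrict (· ≠ i₀)) τ'.1 := by
  rw [pbtSplit_symm_inl, ptupleIdeal_piSplitAt_symm, optIdeal_none, bot_sup_eq]

/-- The ideal of a rejoined tuple with a datum `(a, b)` at `i₀`: `(x_b, x_a) + J_{τ′}`. -/
theorem ptupleIdeal_pbtSplit_symm_inr (q : ℕ)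
    (p : {p : Br B i₀ × PTuple (B.restrict (· ≠ i₀)) // pdeg (B.restrict (· ≠ i₀)) p.2 + 1 = q}) :
    ptupleIdeal K B ((pbtSplit B i₀ q).symm (Sum.inr p)).1 =
      Ideal.span {(X p.1.1.1.2.2 : MvPolynomial (Fin n) K), X p.1.1.1.2.1} ⊔
        ptupleIdeal K (B.restrict (· ≠ i₀)) p.1.2 := by
  rw [pbtSplit_symm_inr, ptupleIdeal_piSplitAt_symm, optIdeal_some]

/-- In degree `k + 1` the second summand is `Br(S_{i₀}) × PBT B′ k`. -/
def brProdEquiv (k : ℕ) :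
    {p : Br B i₀ × PTuple (B.restrict (· ≠ i₀)) // pdeg (B.restrict (· ≠ i₀)) p.2 + 1 = k + 1} ≃
      Br B i₀ × PBT (B.restrict (· ≠ i₀)) k where
  toFun p := (p.1.1, ⟨p.1.2, by have := p.2; omega⟩)
  invFun p := ⟨(p.1, p.2.1), by have := p.2.2; dsimp only; omega⟩
  left_inv _ := rfl
  right_inv _ := rfl

/-- **Re-indexing in degree `k + 1`**:
`Π_{τ : PBT B (k+1)} R ⧸ J_τ ≃ₗ[R] (Π_{τ′ : PBT B′ (k+1)} R ⧸ J_{τ′}) × (Π_{τ′ : PBT B′ k} Π_{t ∈ Br(S_{i₀})} R ⧸ ((x_b, x_a) + J_{τ′}))`. -/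
noncomputable def pbtQuotPiSuccEquiv (k : ℕ) :
    ((τ : PBT B (k + 1)) → MvPolynomial (Fin n) K ⧸ ptupleIdeal K B τ.1) ≃ₗ[MvPolynomial (Fin n) K]
      (((τ' : PBT (B.restrict (· ≠ i₀)) (k + 1)) →
          MvPolynomial (Fin n) K ⧸ ptupleIdeal K (B.restrict (· ≠ i₀)) τ'.1) ×
        ((τ' : PBT (B.restrict (· ≠ i₀)) k) → (t : Br B i₀) →
          MvPolynomial (Fin n) K ⧸
            (Ideal.span {(X t.1.2.2 : MvPolynomial (Fin n) K), X t.1.2.1} ⊔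
              ptupleIdeal K (B.restrict (· ≠ i₀)) τ'.1))) :=
  (LinearEquiv.piCongrLeft' (MvPolynomial (Fin n) K)
      (fun τ : PBT B (k + 1) => MvPolynomial (Fin n) K ⧸ ptupleIdeal K B τ.1) (pbtSplit B i₀ (k + 1))).trans
    ((LinearEquiv.sumPiEquivProdPi (MvPolynomial (Fin n) K) _ _
        (fun s => MvPolynomial (Fin n) K ⧸ ptupleIdeal K B ((pbtSplit B i₀ (k + 1)).symm s).1)).trans
      (LinearEquiv.prodCongr
        (LinearEquiv.piCongrRight fun τ' =>
          Submodule.quotEquivOfEq _ _ (ptupleIdeal_pbtSplit_symm_inl (K := K) B i₀ (k + 1) τ'))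
        (((LinearEquiv.piCongrRight fun p =>
            Submodule.quotEquivOfEq _ _ (ptupleIdeal_pbtSplit_symm_inr (K := K) B i₀ (k + 1) p)).trans
          (LinearEquiv.piCongrLeft' (MvPolynomial (Fin n) K)
            (fun p : {p : Br B i₀ × PTuple (B.restrict (· ≠ i₀)) //
                pdeg (B.restrict (· ≠ i₀)) p.2 + 1 = k + 1} =>
              MvPolynomial (Fin n) K ⧸
                (Ideal.span {(X p.1.1.1.2.2 : MvPolynomial (Fin n) K), X p.1.1.1.2.1} ⊔
                  ptupleIdeal K (B.restrict (· ≠ i₀)) p.1.2))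
            (brProdEquiv B i₀ k))).trans
          (piProdSwapEquiv (A := MvPolynomial (Fin n) K)
            (fun p : Br B i₀ × PBT (B.restrict (· ≠ i₀)) k =>
              MvPolynomial (Fin n) K ⧸
                (Ideal.span {(X p.1.1.2.2 : MvPolynomial (Fin n) K), X p.1.1.2.1} ⊔
                  ptupleIdeal K (B.restrict (· ≠ i₀)) p.2.1))))))

/-- **Re-indexing in degree `0`**: `Π_{τ : PBT B 0} R ⧸ J_τ ≃ₗ[R] Π_{τ′ : PBT B′ 0} R ⧸ J_{τ′}` (no datum at `i₀`). -/
noncomputable def pbtQuotPiZeroEquiv :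
    ((τ : PBT B 0) → MvPolynomial (Fin n) K ⧸ ptupleIdeal K B τ.1) ≃ₗ[MvPolynomial (Fin n) K]
      ((τ' : PBT (B.restrict (· ≠ i₀)) 0) → MvPolynomial (Fin n) K ⧸ ptupleIdeal K (B.restrict (· ≠ i₀)) τ'.1) :=
  haveI : IsEmpty {p : Br B i₀ × PTuple (B.restrict (· ≠ i₀)) // pdeg (B.restrict (· ≠ i₀)) p.2 + 1 = 0} :=
    Subtype.isEmpty_of_false fun p h => by omega
  (LinearEquiv.piCongrLeft' (MvPolynomial (Fin n) K)
      (fun τ : PBT B 0 => MvPolynomial (Fin n) K ⧸ ptupleIdeal K B τ.1) (pbtSplit B i₀ 0)).trans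
    ((LinearEquiv.sumPiEquivProdPi (MvPolynomial (Fin n) K) _ _
        (fun s => MvPolynomial (Fin n) K ⧸ ptupleIdeal K B ((pbtSplit B i₀ 0).symm s).1)).trans
      (LinearEquiv.prodUnique.trans
        (LinearEquiv.piCongrRight fun τ' =>
          Submodule.quotEquivOfEq _ _ (ptupleIdeal_pbtSplit_symm_inl (K := K) B i₀ 0 τ'))))

end PTuples

/-! ## No blocks -/

section Empty

variable {ι : Type} [Fintype ι] [IsEmpty ι] (B : Blocks ι n)

/-- With no blocks the degree of a partial tuple is `0`. -/
theorem pdeg_of_isEmpty (τ : PTuple B) : pdeg B τ = 0 := by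
  simp [pdeg]

/-- With no blocks there is exactly one partial tuple of degree `0`. -/
noncomputable instance uniquePBTZero : Unique (PBT B 0) where
  default := ⟨fun i => isEmptyElim i, pdeg_of_isEmpty B _⟩
  uniq _ := Subtype.ext (funext fun i => isEmptyElim i)

/-- With no blocks there is no partial tuple of positive degree. -/
instance isEmptyPBTSucc (k : ℕ) : IsEmpty (PBT B (k + 1)) :=
  Subtype.isEmpty_of_false fun τ h => by rw [pdeg_of_isEmpty] at h; omega

omit [Fintype ι] in
/-- With no blocks the ideal of a partial tuple is `0`. -/
theorem ptupleIdeal_of_isEmpty (τ : PTuple B) : ptupleIdeal K B τ = ⊥ := by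
  simp [ptupleIdeal]

end Empty

end Summit.Ventures.HSemireg.ObstructionLocus.BlockModel
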